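import Summits.Ventures.CertifiedManyBodySolver.Theorems.R2cStripCellConsumer
import Summits.Ventures.CertifiedManyBodySolver.Upper.UMPSPolarCorrection
import HarnessLib

/-!
# Route `R2cOpenStripTangentLine` — the strip-cell uMPS consumer for STORED (dyadic, nearly isometric) tensors

HONEST FRAMING: first certified bounds; not a superconductivity verdict; every number certified or labelled float.
NO NUMBER IS CLAIMED HERE (`proof.conditional` by design: every bound-valued theorem is an implication from the
data a strip-cell certificate asserts).

`Theorems/R2cStripCellConsumer.lean` consumes an EXACTLY left-isometric cell tensor. A certificate FILE stores a
rounded tensor `A` (integers · 2^{-kbits}) that is only nearly isometric; METHOD-umps §3 (Lemma P,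
`Upper/UMPSPolarCorrection.lean`, generic in the physical dimension) replaces it by the polar tensor
`Ã_S = A_S G^{-1/2}`, `G = Σ_S A_Sᴴ A_S`, which is exactly isometric and satisfies `c·1 − W(Ã; X, Z) ⪰ 0` as soon
as the verifier certified `(c − η)·1 − W(A; X, Z) ⪰ 0` with the explicit slack `η(ε, γ, z)`. The one new point of
this file is that the `U(1)` BLOCK RULE survives the polar correction:

* `apply_eq_zero_of_commute_labelOp`, `commute_labelOp_of_apply`, `commute_labelOp_gram_of_charges` — a matrix
  commutes with the label operator `P̂ = diag lab` iff it is label-diagonal; the Gram matrix of a `U(1)`-blocked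
  tensor is label-diagonal;
* **`polarTensor_charges`** — `G^{-1/2} = cfc(x ↦ x^{-1/2})(G)` commutes with `P̂` (`Commute.cfc_real`), hence
  `Ã` obeys the same block rule `Ã S α β ≠ 0 → lab β + Q = lab α + n(S)`;
* **`m3Upper_tp0_le_m18o25_of_stripCell_umps_dual_dyadic`** — THE CONSUMER FOR STORED DATA: nearly isometric
  `A` (`Σ_j |(G − 1) i j| ≤ ε < 1`), `γ·1 ∓ hh ⪰ 0` for the strip bond matrix `hh = stripCellBondMatrix κ hc 1 8`,
  `z·1 ∓ Z ⪰ 0`, the Lemma-P slack `η ≥ (1 + 1/(1−ε))·(ε/(1−ε))·(1+ε)·(γ(2+ε) + z)`, the certified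
  `(c_cert − η)·1 − W(A; hh, Z) ⪰ 0`, the block rule, `8·Q_c = 7·W·c`, and `c_cert/(W·c) ≤ −18/25` ⇒ the leaf.

Sources: VAR `METHOD-umps.md` §3 (Lemma P) as typed in `Upper/UMPSPolarCorrection.lean`; route pen's `WRITER-II-SPEC.md`;
Horn–Johnson (2013) Thm. 7.3.1(c) [HornJohnson2013]; Ruelle (1969) §3.4 [Ruelle1969].
-/

noncomputable section

open Matrix Finset
open scoped ComplexOrder BigOperators

namespace Summit.Ventures.CertifiedManyBodySolver.Theorems

open Literature.MathematicalPhysics.QuantumLattice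
open Literature.MathematicalPhysics.QuantumLattice.JordanWigner
open Literature.LinearAlgebra.Matrix.PolarOrthonormalization
open Summit.Ventures.CertifiedManyBodySolver.Upper

variable {q D : ℕ}

/-! ### Label-diagonal matrices -/

/-- A matrix commuting with the label operator `diag lab` vanishes between different labels. [folklore] -/
theorem apply_eq_zero_of_commute_labelOp {M : Matrix (Fin D) (Fin D) ℂ} (lab : Fin D → ℤ)
    (h : Commute (diagonal fun α => ((lab α : ℤ) : ℂ)) M) {α β : Fin D} (hne : lab α ≠ lab β) :
    M α β = 0 := by
  have h' := congrFun (congrFun h.eq α) β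
  rw [diagonal_mul, mul_diagonal] at h'
  have hd : (((lab α : ℤ) : ℂ)) - ((lab β : ℤ) : ℂ) ≠ 0 := by
    rw [sub_ne_zero]
    exact_mod_cast hne
  have : ((((lab α : ℤ) : ℂ)) - ((lab β : ℤ) : ℂ)) * M α β = 0 := by rw [sub_mul, h', mul_comm, sub_self]
  exact (mul_eq_zero.mp this).resolve_left hd

/-- A label-diagonal matrix commutes with the label operator. [folklore] -/
theorem commute_labelOp_of_apply {M : Matrix (Fin D) (Fin D) ℂ} (lab : Fin D → ℤ)
    (h : ∀ α β, M α β ≠ 0 → lab α = lab β) : Commute (diagonal fun α => ((lab α : ℤ) : ℂ)) M := by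
  refine Matrix.ext fun α β => ?_
  show (diagonal (fun α => ((lab α : ℤ) : ℂ)) * M) α β = (M * diagonal fun α => ((lab α : ℤ) : ℂ)) α β
  rw [diagonal_mul, mul_diagonal]
  by_cases hM : M α β = 0
  · rw [hM, mul_zero, zero_mul]
  · rw [h α β hM, mul_comm]

/-- **The Gram matrix of a `U(1)`-blocked tensor is label-diagonal** (commutes with `P̂`). [folklore] -/
theorem commute_labelOp_gram_of_charges {A : MPSTensor q D} (nS : Fin q → ℤ) (lab : Fin D → ℤ) (Q : ℤ)
    (hBC : ∀ (s : Fin q) (α β : Fin D), A s α β ≠ 0 → lab β + Q = lab α + nS s) :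
    Commute (diagonal fun α => ((lab α : ℤ) : ℂ)) (gram A) := by
  refine commute_labelOp_of_apply lab fun α β hG => ?_
  rw [Upper.gram, Matrix.sum_apply] at hG
  obtain ⟨s, -, hs⟩ := Finset.exists_ne_zero_of_sum_ne_zero hG
  rw [Matrix.mul_apply] at hs
  obtain ⟨γ, -, hγ⟩ := Finset.exists_ne_zero_of_sum_ne_zero hs
  rw [conjTranspose_apply] at hγ
  have h1 : A s γ α ≠ 0 := fun h0 => hγ (by rw [h0, star_zero, zero_mul])
  have h2 : A s γ β ≠ 0 := fun h0 => hγ (by rw [h0, mul_zero])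
  have e1 := hBC s γ α h1
  have e2 := hBC s γ β h2
  omega

/-- **The polar tensor keeps the `U(1)` block rule** (Lemma P is compatible with the charge structure):
`G^{-1/2}` commutes with the label operator, so `Ã_S = A_S G^{-1/2}` maps sectors exactly as `A_S` does.
[cite: HornJohnson2013, Thm. 7.3.1(c)] -/
theorem polarTensor_charges {A : MPSTensor q D} (nS : Fin q → ℤ) (lab : Fin D → ℤ) (Q : ℤ)
    (hBC : ∀ (s : Fin q) (α β : Fin D), A s α β ≠ 0 → lab β + Q = lab α + nS s) :
    ∀ (s : Fin q) (α β : Fin D), polarTensor A s α β ≠ 0 → lab β + Q = lab α + nS s := by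
  have hcomm : Commute (diagonal fun α => ((lab α : ℤ) : ℂ)) (invSqrt (gram A)) := by
    unfold invSqrt
    exact (Commute.cfc_real (commute_labelOp_gram_of_charges nS lab Q hBC).symm _).symm
  intro s α β h
  change (A s * invSqrt (gram A)) α β ≠ 0 at h
  rw [Matrix.mul_apply] at h
  obtain ⟨γ, -, hγ⟩ := Finset.exists_ne_zero_of_sum_ne_zero h
  have h1 : A s α γ ≠ 0 := left_ne_zero_of_mul hγ
  have h2 : invSqrt (gram A) γ β ≠ 0 := right_ne_zero_of_mul hγ
  have h3 : lab γ = lab β := by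
    by_contra hne
    exact h2 (apply_eq_zero_of_commute_labelOp lab hcomm hne)
  have := hBC s α γ h1
  omega

/-! ### The consumer for stored tensors -/

variable {W c Q : ℕ}

/-- **STRIP-CELL uMPS CONSUMER FOR STORED (NEARLY ISOMETRIC) TENSORS.** DATA of an `a = ∞` strip-cell certificate
on the STORED dyadic tensor `A : Fin Q → M_D(ℂ)` (cell configurations enumerated by `κ`; `(t, t′, U) = (1, 0, 8)`,
`μ = 0`): `Σ_j |(G − 1) i j| ≤ ε` for every row of the Gram matrix `G = Σ_S A_Sᴴ A_S`, `0 ≤ ε < 1`; a two-sided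
Loewner bound `γ·1 ∓ hh ⪰ 0` (`γ ≥ 0`) of the strip bond matrix `hh = stripCellBondMatrix κ hc 1 8`; a unit boundary
vector `r`; a dual matrix `Z` with `z·1 ∓ Z ⪰ 0` (`z ≥ 0`); a slack `η ≥ (1 + 1/(1−ε))·(ε/(1−ε))·(1+ε)·(γ(1+(1+ε)) + z)`
(METHOD-umps §3 Lemma P) and the certified inequality `(c_cert − η)·1 − W(A; hh, Z) ⪰ 0`; integer bond labels
`lab ∈ [qmin, qmax]` with the `U(1)` block rule for `A` and cell charge `Q_c`, `8·Q_c = 7·W·c`; and the bar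
`c_cert/(W·c) ≤ −18/25`. THEN `e(1, 0, 8, 7/8) ≤ −18/25` — via the polar tensor (exactly isometric, same block rule,
`c_cert·1 − W(Ã; hh, Z) ⪰ 0`) and `m3Upper_tp0_le_m18o25_of_stripCell_umps_dual`. [cite: Ruelle1969, §3.4] -/
theorem m3Upper_tp0_le_m18o25_of_stripCell_umps_dual_dyadic (W c : ℕ) (hW : 1 ≤ W) (hc : 0 < c)
    (κ : TensorIndex (Fin c ×ₗ Fin W) 4 ≃ Fin Q) (A : MPSTensor Q D) {ε γ η : ℝ} (hε0 : 0 ≤ ε) (hε1 : ε < 1)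
    (hγ : 0 ≤ γ) (hG : ∀ i, ∑ j, ‖(gram A - 1) i j‖ ≤ ε)
    (hX₁ : ((γ : ℂ) • (1 : Matrix (Fin Q × Fin Q) (Fin Q × Fin Q) ℂ) - stripCellBondMatrix κ hc 1 8).PosSemidef)
    (hX₂ : ((γ : ℂ) • (1 : Matrix (Fin Q × Fin Q) (Fin Q × Fin Q) ℂ) + stripCellBondMatrix κ hc 1 8).PosSemidef)
    (r : Fin D → ℂ) (hr : star r ⬝ᵥ r = 1) (Z : Matrix (Fin D) (Fin D) ℂ) (cc z : ℚ) (hz : 0 ≤ z)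
    (hZ₁ : ((((z : ℚ) : ℝ) : ℂ) • (1 : Matrix (Fin D) (Fin D) ℂ) - Z).PosSemidef)
    (hZ₂ : ((((z : ℚ) : ℝ) : ℂ) • (1 : Matrix (Fin D) (Fin D) ℂ) + Z).PosSemidef)
    (hη : (1 + 1 / (1 - ε)) * (ε / (1 - ε)) * (1 + ε) * (γ * (1 + (1 + ε)) + ((z : ℚ) : ℝ)) ≤ η)
    (hdual : (((((cc : ℚ) : ℝ) - η : ℝ) : ℂ) • (1 : Matrix (Fin D) (Fin D) ℂ) -
      dualMatrix A (stripCellBondMatrix κ hc 1 8) Z).PosSemidef)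
    (lab : Fin D → ℤ) (Qc qmin qmax : ℤ)
    (hBC : ∀ (S : Fin Q) (α β : Fin D), A S α β ≠ 0 →
      lab β + Qc = lab α + ((∑ f, siteCharge (κ.symm S f) : ℕ) : ℤ))
    (hlab : ∀ α, qmin ≤ lab α ∧ lab α ≤ qmax) (hQc : (8 : ℤ) * Qc = 7 * ((W : ℤ) * (c : ℤ)))
    (hbar : cc / ((W : ℚ) * (c : ℚ)) ≤ -18 / 25) :
    Summit.Ventures.CertifiedManyBodySolver.MbsolverRungLeaves.M3Upper_tp0_le_m18o25 := by
  have hz' : (0 : ℝ) ≤ ((z : ℚ) : ℝ) := by exact_mod_cast hz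
  obtain ⟨hiso, hdual'⟩ := polarTensor_dual_certificate hε0 hε1 hγ hz' hG hX₁ hX₂ hZ₁ hZ₂ hη hdual
  exact m3Upper_tp0_le_m18o25_of_stripCell_umps_dual W c hW hc κ (polarTensor A) hiso r hr Z cc z hdual' hZ₁ hZ₂
    lab Qc qmin qmax (polarTensor_charges _ lab Qc hBC) hlab hQc hbar

end Summit.Ventures.CertifiedManyBodySolver.Theorems

end
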